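import Mathlib
import HarnessLib

/-!
# `RationalShortRootRigidity` — Step 1 helper (m14): Bézout over the spatial field ℝ(q) with cleared denominators

Helper lemma INSIDE the paper proof of crux `stmt-QuantumFields-23124` (`F4SubCurvatureDoor.RationalShortRootRigidity`, LINE g15-A
of planner ym-idea-3; Step 1 = `stub_reduce`; free-hands MENU IV, item (m14), statement typed in HOME l15/Helpers23124c.lean as
`Helpers.BezoutOverSpatialField` — proved here DEF-FREE with that body verbatim):

**Lemma** (`bezoutOverSpatialField`).  A coprime pair `N₀, D₀ ∈ ℝ[p₀, q₁, q₂, q₃]` (`IsRelPrime`, `D₀ ≠ 0`) satisfies a Bézout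
identity `A·N₀ + B·D₀ = R(q)` with a NON-ZERO right-hand side depending on the spatial variables `q` only.

Proof.  Write `ℝ[p₀,q] = S[t]`, `S = ℝ[q]` (`MvPolynomial.finSuccEquiv`), `K = Frac S = ℝ(q)`.
* §1 `isCoprime_map_of_isRelPrime` (generic, any UFD `S`): relatively prime in `S[t]` ⇒ coprime in `K[t]` — GAUSS'S LEMMA: a common
  divisor `d ∈ K[t]` clears denominators (`IsLocalization.integerNormalization`) to `d′ = content·e ∈ S[t]`, `e` primitive, and
  `Polynomial.IsPrimitive.dvd_of_fraction_map_dvd_fraction_map` puts `e ∣ N₀`, `e ∣ D₀` in `S[t]`, so `e` — hence `d` — is a unit;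
  `K[t]` is a PID, so `IsRelPrime ⇔ IsCoprime`.
* §2 the identity in `S[t]`: if one of the `t`-degrees is positive, Mathlib's Sylvester/resultant Bézout identity
  `Polynomial.exists_mul_add_mul_eq_C_resultant` gives `N₀·p + D₀·q = C(Res_t(N₀, D₀))` and `Res ≠ 0` because the `K[t]`-images are
  coprime (`Polynomial.resultant_eq_zero_iff`, `resultant_map_map`); if both degrees vanish, `D₀ = R(q)` itself and `0·N₀ + 1·D₀ = R`.

Mathlib only; THEOREMS ONLY (no definitions); no named facts; no `sorry`.  Nothing about the crux 23124, the route's rung (R2d) or the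
Yang–Mills mass gap is proved here.  Width seat `ym-line-sfw-p2-w2` g23 (cell ym-idea-1; free hands), `--supports stmt-QuantumFields-23124`.
[cite: Ruelle1969, §4.2]
-/

set_option autoImplicit false

noncomputable section

open MvPolynomial

namespace Summit.QuantumFields.YangMills.Theorems.RationalShortRootRigidity

/-! ## §1 Gauss: relatively prime over the UFD `S` ⇒ coprime over its fraction field -/

/-- **Gauss's lemma, coprimality form.**  Over a UFD `S` with fraction field `K`: if `f, g ∈ S[t]` are relatively prime
(`IsRelPrime`: every common divisor is a unit) and `g ≠ 0`, then their images in `K[t]` are coprime (Bézout). [folklore] -/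
theorem isCoprime_map_of_isRelPrime {S : Type*} [CommRing S] [IsDomain S] [UniqueFactorizationMonoid S]
    {K : Type*} [Field K] [Algebra S K] [IsFractionRing S K] {f g : Polynomial S}
    (h : IsRelPrime f g) (hg : g ≠ 0) :
    IsCoprime (f.map (algebraMap S K)) (g.map (algebraMap S K)) := by
  classical
  letI : NormalizationMonoid S :=
    (UniqueFactorizationMonoid.strongNormalizationMonoid (α := S)).toNormalizationMonoid
  letI : NormalizedGCDMonoid S := UniqueFactorizationMonoid.toNormalizedGCDMonoid S
  rw [← isRelPrime_iff_isCoprime]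
  intro d hdf hdg
  have hinj : Function.Injective (algebraMap S K) := IsFractionRing.injective S K
  have hgK : g.map (algebraMap S K) ≠ 0 := (Polynomial.map_ne_zero_iff hinj).mpr hg
  have hd0 : d ≠ 0 := by
    rintro rfl
    exact hgK (zero_dvd_iff.mp hdg)
  -- clear denominators: `d' ∈ S[t]` with `d'.map = b • d`, `b ≠ 0`
  obtain ⟨b, hb, hbd⟩ := IsLocalization.integerNormalization_spec (nonZeroDivisors S) d
  set d' : Polynomial S := IsLocalization.integerNormalization (nonZeroDivisors S) d with hd'def
  have hb0 : b ≠ 0 := nonZeroDivisors.ne_zero hb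
  have hbK : algebraMap S K b ≠ 0 := fun h0 => hb0 (hinj (by rw [h0, map_zero]))
  have hbd' : d'.map (algebraMap S K) = Polynomial.C (algebraMap S K b) * d := by
    rw [hbd, Algebra.smul_def, Polynomial.algebraMap_apply]
  have hd'0 : d' ≠ 0 := by
    intro h0
    rw [h0, Polynomial.map_zero] at hbd'
    exact hd0 ((mul_eq_zero.mp hbd'.symm).resolve_left (Polynomial.C_ne_zero.mpr hbK))
  -- primitive part
  set c : S := d'.content with hcdef
  set e : Polynomial S := d'.primPart with hedef
  have hc0 : c ≠ 0 := by rw [hcdef, Ne, Polynomial.content_eq_zero_iff]; exact hd'0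
  have hcK : algebraMap S K c ≠ 0 := fun h0 => hc0 (hinj (by rw [h0, map_zero]))
  have hde : d' = Polynomial.C c * e := d'.eq_C_content_mul_primPart
  have he : e.IsPrimitive := d'.isPrimitive_primPart
  -- `e.map = C((ι c)⁻¹ · ι b) · d`
  have hemap : e.map (algebraMap S K) =
      Polynomial.C ((algebraMap S K c)⁻¹ * algebraMap S K b) * d := by
    have h1 : d'.map (algebraMap S K) = Polynomial.C (algebraMap S K c) * e.map (algebraMap S K) := by
      conv_lhs => rw [hde]
      rw [Polynomial.map_mul, Polynomial.map_C]
    have h2 : Polynomial.C (algebraMap S K c) * e.map (algebraMap S K) = Polynomial.C (algebraMap S K b) * d :=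
      h1.symm.trans hbd'
    calc e.map (algebraMap S K)
        = Polynomial.C ((algebraMap S K c)⁻¹) * (Polynomial.C (algebraMap S K c) * e.map (algebraMap S K)) := by
          rw [← mul_assoc, ← Polynomial.C_mul, inv_mul_cancel₀ hcK, Polynomial.C_1, one_mul]
      _ = Polynomial.C ((algebraMap S K c)⁻¹) * (Polynomial.C (algebraMap S K b) * d) := by rw [h2]
      _ = Polynomial.C ((algebraMap S K c)⁻¹ * algebraMap S K b) * d := by rw [← mul_assoc, ← Polynomial.C_mul]
  have hunit : IsUnit (Polynomial.C ((algebraMap S K c)⁻¹ * algebraMap S K b)) :=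
    Polynomial.isUnit_C.mpr (isUnit_iff_ne_zero.mpr (mul_ne_zero (inv_ne_zero hcK) hbK))
  -- Gauss: `e ∣ q` in `S[t]` whenever `d ∣ q.map` in `K[t]`
  have key : ∀ q : Polynomial S, d ∣ q.map (algebraMap S K) → e ∣ q := by
    intro q hq
    refine he.dvd_of_fraction_map_dvd_fraction_map (K := K) ?_
    rw [hemap]
    exact (hunit.mul_left_dvd).mpr hq
  have heu : IsUnit e := h (key f hdf) (key g hdg)
  have hemu : IsUnit (e.map (algebraMap S K)) := heu.map (Polynomial.mapRingHom (algebraMap S K))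
  -- `d = C(unit⁻¹) · e.map` is a unit
  have hd : d = Polynomial.C (((algebraMap S K c)⁻¹ * algebraMap S K b)⁻¹) * e.map (algebraMap S K) := by
    rw [hemap, ← mul_assoc, ← Polynomial.C_mul, inv_mul_cancel₀ (mul_ne_zero (inv_ne_zero hcK) hbK),
      Polynomial.C_1, one_mul]
  rw [hd]
  exact (Polynomial.isUnit_C.mpr (isUnit_iff_ne_zero.mpr
    (inv_ne_zero (mul_ne_zero (inv_ne_zero hcK) hbK)))).mul hemu

/-! ## §2 The Bézout identity with a spatial right-hand side -/

/-- The equivalence `ℝ[p₀, q] ≃ ℝ[q][t]` sends a `q`-only polynomial to a constant. [folklore] -/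
theorem finSuccEquiv_rename_succ (R : MvPolynomial (Fin 3) ℝ) :
    MvPolynomial.finSuccEquiv ℝ 3 (rename Fin.succ R) = Polynomial.C R := by
  induction R using MvPolynomial.induction_on with
  | C a => simp [MvPolynomial.finSuccEquiv_apply]
  | add p q hp hq => simp [map_add, hp, hq]
  | mul_X p i hp => simp [map_mul, hp, MvPolynomial.finSuccEquiv_X_succ]

/-- ★ **(m14) Bézout over the spatial field** (`Helpers.BezoutOverSpatialField`, verbatim): a coprime pair in `ℝ[p₀, q]` satisfies a
Bézout identity with a non-zero `q`-only right-hand side. [folklore] -/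
theorem bezoutOverSpatialField :
    ∀ N₀ D₀ : MvPolynomial (Fin 4) ℝ, IsRelPrime N₀ D₀ → D₀ ≠ 0 →
      ∃ (A B : MvPolynomial (Fin 4) ℝ) (R : MvPolynomial (Fin 3) ℝ), R ≠ 0 ∧ A * N₀ + B * D₀ = rename Fin.succ R := by
  intro N₀ D₀ hrel hD
  set φ := MvPolynomial.finSuccEquiv ℝ 3 with hφ
  set f : Polynomial (MvPolynomial (Fin 3) ℝ) := φ N₀ with hf
  set g : Polynomial (MvPolynomial (Fin 3) ℝ) := φ D₀ with hg
  have hN : φ.symm f = N₀ := by rw [hf, AlgEquiv.symm_apply_apply]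
  have hDs : φ.symm g = D₀ := by rw [hg, AlgEquiv.symm_apply_apply]
  have hg0 : g ≠ 0 := by
    intro h0; apply hD; rw [← hDs, h0, map_zero]
  -- relative primality passes through the ring isomorphism
  have hrel' : IsRelPrime f g := by
    intro d hdf hdg
    have h1 : φ.symm d ∣ N₀ := by rw [← hN]; exact map_dvd φ.symm hdf
    have h2 : φ.symm d ∣ D₀ := by rw [← hDs]; exact map_dvd φ.symm hdg
    have hu := (hrel h1 h2).map φ
    rwa [AlgEquiv.apply_symm_apply] at hu
  by_cases hdeg : f.natDegree = 0 ∧ g.natDegree = 0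
  · -- both constant in `t`: `D₀` is itself a (non-zero) spatial polynomial
    obtain ⟨-, hg0deg⟩ := hdeg
    have hgC : g = Polynomial.C (g.coeff 0) := Polynomial.eq_C_of_natDegree_eq_zero hg0deg
    refine ⟨0, 1, g.coeff 0, ?_, ?_⟩
    · intro h0; apply hg0; rw [hgC, h0, map_zero]
    · rw [zero_mul, zero_add, one_mul]
      apply φ.injective
      rw [finSuccEquiv_rename_succ, ← hgC]
  · -- a positive `t`-degree: Sylvester–Bézout identity with the resultant
    have H : f.natDegree ≠ 0 ∨ g.natDegree ≠ 0 := by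
      rcases not_and_or.mp hdeg with h | h
      · exact Or.inl h
      · exact Or.inr h
    obtain ⟨p, q, -, -, e⟩ := Polynomial.exists_mul_add_mul_eq_C_resultant f g le_rfl le_rfl H
    set Rr := Polynomial.resultant f g f.natDegree g.natDegree with hRr
    -- `Rr ≠ 0`: the fraction-field images are coprime (§1)
    have hRr0 : Rr ≠ 0 := by
      intro h0
      let K := FractionRing (MvPolynomial (Fin 3) ℝ)
      let ι := algebraMap (MvPolynomial (Fin 3) ℝ) K
      have hinj : Function.Injective ι := IsFractionRing.injective _ _
      have hcop : IsCoprime (f.map ι) (g.map ι) := isCoprime_map_of_isRelPrime hrel' hg0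
      have hres : Polynomial.resultant (f.map ι) (g.map ι) = 0 := by
        rw [Polynomial.natDegree_map_eq_of_injective hinj, Polynomial.natDegree_map_eq_of_injective hinj,
          Polynomial.resultant_map_map, ← hRr, h0, map_zero]
      exact ((Polynomial.resultant_eq_zero_iff.mp hres).2) hcop
    refine ⟨φ.symm p, φ.symm q, Rr, hRr0, ?_⟩
    apply φ.injective
    rw [finSuccEquiv_rename_succ, map_add, map_mul, map_mul, AlgEquiv.apply_symm_apply, AlgEquiv.apply_symm_apply,
      ← hf, ← hg, ← e]
    ring

end Summit.QuantumFields.YangMills.Theorems.RationalShortRootRigidity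

end
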